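import Mathlib
import Summits.NavierStokesRegularity.NavierStokesRegularity.Theorems.WakeRatchetTailRatchetEternalFloor
import HarnessLib

/-!
# `WakeRatchet.TailRatchet` (stmt-NavierStokesRegularity-21808) and the ladder's Liouville predicates:
# the SMALL-AMPLITUDE SLICE of K1ᵛ holds unconditionally — no admissible eternal solution with type-I
# constant `≤ 1/(896 ε₀)` exists (let alone survives) on any `E₂(R)` table

Support file (route `WakeRatchet`; MODEL lattice ODEs of Tao 2016 §4 — nothing here is a statement
about the Navier–Stokes equations; no item is closed).

The rung predicates of the Tao ladder (`NoSurvivingEternalVisc R a`, `NoSurvivingEternalBdd R a`, the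
tail ratchets 21808/25584/25646/25647) all quantify over admissible eternal solutions `W` of the
renormalised lattice (`IsEternalVisc ε₀ ν̂ α W`).  By the sharp gap theorem
(`WakeRatchetEternalFloor.eq_zero_of_small_bound_sharp`) such a `W` with
`(Λ − Λ⁻¹)·fluxConst α·sup‖W‖ < 1` is identically zero.  Consequences recorded here, in the ladder's
vocabulary:

* `eq_zero_of_bound_le` — on a cancelling `R`-comparable table, `0 < ε₀ ≤ 1`, any `ν̂`:
  `‖W_n(σ)‖ ≤ 1/(896 ε₀)` for all `n, σ` ⇒ `W ≡ 0`;
* `not_surviving_of_bound_le` — hence such a `W` is not forward `(S_a)`-surviving for ANY exponent `a`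
  (`¬ EternalSurvivingFwd a ε₀ W`): the small-amplitude slice of the viscous Liouville predicate K1ᵛ
  holds for every `R`, every `a`, every `ε₀ ∈ (0,1]`, with the explicit amplitude threshold `1/(896 ε₀)`;
* `surviving_large` — contrapositive: a forward-surviving admissible eternal solution (the object the
  extraction cruxes K2ᵛ / `EternalRigidityViscBddOne` produce) has `‖W_n(σ)‖ > 1/(896 ε₀)` somewhere.

HONEST FRAMING: a slice, not the rung: K1ᵛ itself (no surviving solution of ANY size) stays open.
-/

noncomputable section

set_option linter.dupNamespace false

namespace Summit.NavierStokesRegularity.NavierStokesRegularity.Theorems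

namespace WakeRatchetSmallAmplitudeLiouville

open MeasureTheory Set Filter Topology
open Literature.Analysis.FluidPDE Literature.Analysis.FluidPDE.TaoCascade
open WakeRatchetEternalFloor

variable {ε₀ νh R : ℝ} {α : Fin 4 → Fin 4 → Fin 4 → ℤ × ℤ × ℤ → ℝ} {W : ℤ → ℝ → Em 4}

/-- **Small admissible eternal solutions are trivial** (comparable tables, `0 < ε₀ ≤ 1`, any `ν̂ ≥ 0`):
`‖W_n(σ)‖ ≤ 1/(896 ε₀)` everywhere forces `W ≡ 0`.
[cite: Tao2016AveragedNS, §4 (4.1)–(4.3), Lemma 4.1 (4.8)–(4.10), §6.1, §6.4; cell theorem] -/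
theorem eq_zero_of_bound_le (hε : 0 < ε₀) (hε1 : ε₀ ≤ 1) (hα : InTableClass R α)
    (hW : IsEternalVisc ε₀ νh α W) (hsmall : ∀ (n : ℤ) (σ : ℝ), ‖W n σ‖ ≤ 1 / (896 * ε₀)) :
    ∀ (n : ℤ) (σ : ℝ), W n σ = 0 := by
  by_contra h
  push Not at h
  obtain ⟨n, σ, hnz⟩ := h
  obtain ⟨n', σ', hlt⟩ := tailRatchet_scope_floor hε hε1 hα hW ⟨n, σ, hnz⟩
  exact absurd (hsmall n' σ') (not_le.2 hlt)

/-- **The small-amplitude slice of K1ᵛ.**  On an `E₂(R)` table at scale ratio `1+ε₀`, `0 < ε₀ ≤ 1`, an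
admissible eternal solution with any covariant viscosity and `‖W_n(σ)‖ ≤ 1/(896 ε₀)` for all `n, σ` is
not forward `(S_a)`-surviving, for every exponent `a` (indeed it is zero).
[cite: Tao2016AveragedNS, §4 Thm. 4.2 (statement shape), §6.4; cell theorem] -/
theorem not_surviving_of_bound_le (hε : 0 < ε₀) (hε1 : ε₀ ≤ 1) (hα : InTableClass R α)
    (hW : IsEternalVisc ε₀ νh α W) (hsmall : ∀ (n : ℤ) (σ : ℝ), ‖W n σ‖ ≤ 1 / (896 * ε₀)) (a : ℝ) :
    ¬ EternalSurvivingFwd a ε₀ W := by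
  rintro ⟨c, hc, hN⟩
  obtain ⟨n, -, σ, -, hle⟩ := hN 0
  have h0 : W n σ = 0 := eq_zero_of_bound_le hε hε1 hα hW hsmall n σ
  rw [h0, norm_zero] at hle
  have : c ≤ 0 := by simpa using hle
  linarith

/-- **Surviving eternal solutions are large.**  A forward `(S_a)`-surviving admissible eternal solution
(any `ν̂`, any `a`) of an `E₂(R)` table at scale ratio `1+ε₀`, `0 < ε₀ ≤ 1`, has a shell value of norm
`> 1/(896 ε₀)` — the objects delivered by the extraction cruxes (`EternalRigidityViscBdd R 1`) have type-I
constant `≳ ε₀⁻¹`. [cite: Tao2016AveragedNS, §4 Thm. 4.2 (statement shape), §6.4; cell theorem] -/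
theorem surviving_large (hε : 0 < ε₀) (hε1 : ε₀ ≤ 1) (hα : InTableClass R α)
    (hW : IsEternalVisc ε₀ νh α W) {a : ℝ} (hs : EternalSurvivingFwd a ε₀ W) :
    ∃ (n : ℤ) (σ : ℝ), 1 / (896 * ε₀) < ‖W n σ‖ := by
  by_contra h
  push Not at h
  exact not_surviving_of_bound_le hε hε1 hα hW h a hs

end WakeRatchetSmallAmplitudeLiouville

end Summit.NavierStokesRegularity.NavierStokesRegularity.Theorems

end
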